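import Literature.MathematicalPhysics.QuantumFieldTheory.Balaban1983to89.T4PrecisionDecay

/-!
# PrecisionDecayWitness — the end-to-end NE1′ tower bound of `T4PrecisionDecay` is INHABITED

`[folklore]` throughout, 0 citations.  HONEST FRAMING: finite `T⁴`, rung (B)+1 of the cell's
ladder; NO statement about Bałaban's renormalisation-group tower, NOT about infinite volume, NOT
about a mass gap, NOT about the Clay problem.  BetaPertH, (B), (B^μ) and the binders of the wall
MI-ES-W⁗ (record `t4/T4-EST-NE1p-P2.md`) are neither used nor discharged for that tower.

WHAT THIS LEAF IS.  The lineage `t4-ne1p-p2` («coupling of block-spin towers», node NE1′ (O3b/H2))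
ends, after twelve Literature-side leaves, in ONE kernel-checked theorem with about 120 binders,
`T4PrecisionDecay.integral_sq_sub_towerMean_le_of_graded_geometric_analyticInteraction_precisionDecay_torus_pathLaw`
(finite path law realised by Markov fibre kernels in GRAM-WHITENED GIBBS FORM; raw interaction
expanded on a convex raw box into localised holomorphic terms plus a quadratic residual; coercive,
exponentially decaying Gram precision `BᵀB` in the torus distance of the injected raw sites;
graded-geometric raw Efron–Stein sensitivities; smallness conditions `… ≤ α₀ < 1`, `… ≤ ω`).  Its
undischarged binders are the typed wall MI-ES-W⁗.  Such a statement could be VACUOUS (mutually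
contradictory binders).  This leaf REFUTES that possibility: it constructs explicit data meeting
every binder simultaneously and applies the theorem (`witness`).

THE TOY TOWER (§2–§4).  Levels `ℝ`; one raw site, one whitened site, one localised term per step
(`Unit`); reference law = Lebesgue on `[0, 1]` (`unitLaw`); reading `e y = clamp(2y − 1)` (Mathlib's
`Set.projIcc (-1) 1`); mean `0`, first-order operator `B = 1` (whitening factor `1`, `ξ = e(η)`);
raw box `[−1, 1]`, radius `1`; raw interaction `λ ξ` = ONE entire localised term bounded by `2λ` on
the thickened box, ZERO residual; fibre kernel = push-forward of the TILTED law `e^{−λ ξ} π(dη)/Z`,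
`λ > 0` (`stepLaw`, history-independent); observable `clamp(x 1)` with raw sensitivities `c 0 = 1`,
`c b = 0` (`b ≥ 1`) computed through the fibre means (`lipOn_sens`); profile `Θ = c`, `C = κ₁ = 1`,
no bad events, `P = 4 e^ω`, `r = 1/2`; torus data: any `d`, any `Pv ≥ 1`, whole torus, `N₀ = 1`, the
site at the origin, `γ₀ = c₀ = δ₀ = β_r = β_c = 1`, `N = K_d(δ₁) + 1`, `δ₁ = delta1 d 1 1 1 1`; the
coupling `λ = 1/(256 N²)` makes `hα` hold WITH EQUALITY at `α₀ = 1/2` (`smallness_eq`); `ω = 8 λ N`.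

THE RESULT (§5, `witness`): for every `d`, `Pv ≥ 1`, depth `n ≥ 1` and finite endpoint law `ν`,
`∫ (clamp(x 1) − towerMean κ' φ (x 0))² dμ ≤ 32 · N² · e^{ω} · μ(univ)` — the lineage's theorem,
instantiated.  WHAT IT IS NOT: not a discharge of MI-ES-W⁗ for Bałaban's tower (there `hrep`, the
SIZES `γ₀, c₀, δ₀`, the analyticity radius, the term counts and the sensitivity profile remain
displayed hypotheses: record §5–§7, GAPS `G-ne1p2-ES-precision`); the toy exercises every binder at
face value, not the combinatorial difficulty of the real tower.  No Literature fact consumed; no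
`sorry`; standard axioms.
-/

noncomputable section

open MeasureTheory ProbabilityTheory Finset Function Matrix Metric
open scoped ENNReal

namespace Summit.QuantumFields.BalabanUV.T4Continuum.PrecisionDecayWitness

open Literature.MathematicalPhysics.QuantumFieldTheory.Balaban1983to89 T4CouplingChain
  T4DobrushinTensorisation T4GaussianWhitening T4WhiteningFactor T4InteractionTransport
  T4InteractionCauchy T4PrecisionDecay QGQInverse B4Sect5Torus
open Preorder MeasureTheory.Filtration

/-! ## §1 The reading and the observable (Mathlib's clamp `Set.projIcc (-1) 1`) -/

/-- `[folklore]` The reading of a whitened value `y ∈ [0, 1]`: `2y − 1` clamped to `[-1, 1]`. -/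
def reading (y : ℝ) : ℝ := Set.projIcc (-1 : ℝ) 1 (neg_le_self zero_le_one) (2 * y - 1)

/-- `[folklore]` The reading lies in `[-1, 1]`. -/
theorem reading_mem (y : ℝ) : reading y ∈ Set.Icc (-1 : ℝ) 1 := (Set.projIcc _ _ _ _).2

/-- `[folklore]` `|reading y| ≤ 1`. -/
theorem abs_reading_le (y : ℝ) : |reading y| ≤ 1 :=
  abs_le.2 ⟨(reading_mem y).1, (reading_mem y).2⟩

/-- `[folklore]` The reading is continuous. -/
theorem continuous_reading : Continuous reading := by
  unfold reading; fun_prop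

/-- `[folklore]` The levels of the toy tower: a real number at every depth. -/
abbrev Level : ℕ → Type := fun _ => ℝ

/-- `[folklore]` The observable: the level-`1` coordinate of a path, clamped to `[-1, 1]`. -/
def obs : (Π n, Level n) → ℝ := fun x => Set.projIcc (-1 : ℝ) 1 (neg_le_self zero_le_one) (x 1)

/-- `[folklore]` `|obs x| ≤ 1`. -/
theorem abs_obs_le (x : Π n, Level n) : |obs x| ≤ 1 :=
  abs_le.2 ⟨(Set.projIcc _ _ _ _).2.1, (Set.projIcc _ _ _ _).2.2⟩

/-- `[folklore]` The clamp `ℝ → [-1, 1] ⊆ ℝ` is continuous (Mathlib). -/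
theorem continuous_coe_projIcc :
    Continuous (fun t : ℝ => (Set.projIcc (-1 : ℝ) 1 (neg_le_self zero_le_one) t : ℝ)) := by
  fun_prop

/-- `[folklore]` The observable is measurable. -/
theorem measurable_obs : Measurable obs :=
  continuous_coe_projIcc.measurable.comp (measurable_pi_apply 1)

/-! ## §2 The one-step data: reference law, whitened field, tilted step law, fibre kernels -/

/-- `[folklore]` The reference law of a whitened site: Lebesgue measure on `[0, 1]`. -/
def unitLaw : Measure ℝ := volume.restrict (Set.Icc 0 1)

/-- `[folklore]` It is a probability measure. -/
instance isProbabilityMeasure_unitLaw : IsProbabilityMeasure unitLaw :=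
  ⟨by simp [unitLaw, Real.volume_Icc]⟩

/-- `[folklore]` The whitened raw field of the toy step: `affine 0 ((1ᵀ1)⁻¹1ᵀ) e η`. -/
def whitened (η : Unit → ℝ) : Unit → ℝ :=
  affine (fun _ : Unit => (0 : ℝ)) (whiteningFactor (1 : Matrix Unit Unit ℝ))
    (fun _ : Unit => reading) η

/-- `[folklore]` The whitening factor of `B = 1` is `1`. -/
theorem whiteningFactor_one : whiteningFactor (1 : Matrix Unit Unit ℝ) = 1 := by
  simp [whiteningFactor]

/-- `[folklore]` The whitened raw field is the reading of the whitened value. -/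
theorem whitened_apply (η : Unit → ℝ) (l : Unit) : whitened η l = reading (η ()) := by
  obtain ⟨⟩ := l
  simp [whitened, affine_apply, whiteningFactor_one]

/-- `[folklore]` `|whitened η l| ≤ 1`. -/
theorem abs_whitened_le (η : Unit → ℝ) (l : Unit) : |whitened η l| ≤ 1 := by
  rw [whitened_apply]; exact abs_reading_le _

/-- `[folklore]` Measurability of the whitened raw coordinate. -/
theorem measurable_whitened_apply : Measurable (fun η : Unit → ℝ => whitened η ()) := by
  have h : (fun η : Unit → ℝ => whitened η ()) = fun η => reading (η ()) :=
    funext fun η => whitened_apply η ()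
  rw [h]; exact continuous_reading.measurable.comp (measurable_pi_apply _)

/-- `[folklore]` The energy `λ ξ` of the toy step is measurable. -/
theorem measurable_energy (lam : ℝ) : Measurable (fun η : Unit → ℝ => lam * whitened η ()) :=
  measurable_whitened_apply.const_mul lam

/-- `[folklore]` The energy is bounded by `|λ|`. -/
theorem abs_energy_le (lam : ℝ) (η : Unit → ℝ) : |lam * whitened η ()| ≤ |lam| := by
  rw [abs_mul]; exact mul_le_of_le_one_right (abs_nonneg _) (abs_whitened_le η ())

/-- `[folklore]` THE TILTED STEP LAW: the push-forward of the Gibbs law `e^{−λ ξ(η)} π(dη) / Z`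
under the whitened raw coordinate — EXACTLY the Gram-whitened Gibbs form of the binder `hrep`. -/
def stepLaw (lam : ℝ) : Measure ℝ :=
  (gibbsMeasure (fun _ : Unit => unitLaw) (fun η => lam * whitened η ())).map
    (fun η => whitened η ())

/-- `[folklore]` The tilted step law is a probability measure. -/
instance isProbabilityMeasure_stepLaw (lam : ℝ) : IsProbabilityMeasure (stepLaw lam) := by
  haveI : IsProbabilityMeasure
      (gibbsMeasure (fun _ : Unit => unitLaw) (fun η => lam * whitened η ())) :=
    isProbabilityMeasure_gibbsMeasure (measurable_energy lam) (abs_energy_le lam)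
  exact Measure.isProbabilityMeasure_map measurable_whitened_apply.aemeasurable

/-- `[folklore]` THE FIBRE KERNELS of the toy tower: one draw from the tilted step law. -/
def stepKernel (lam : ℝ) (b : ℕ) : Kernel (Π i : Iic b, Level i) (Level (b + 1)) :=
  Kernel.const _ (stepLaw lam)

/-- `[folklore]` The fibre kernels are Markov. -/
instance isMarkovKernel_stepKernel (lam : ℝ) (b : ℕ) : IsMarkovKernel (stepKernel lam b) := by
  unfold stepKernel; infer_instance

/-- `[folklore]` Unfolding of the fibre kernels. -/
theorem stepKernel_apply (lam : ℝ) (b : ℕ) (h : Π i : Iic b, Level i) :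
    stepKernel lam b h = stepLaw lam := rfl

/-! ## §3 Fibre means of the observable and its raw Efron–Stein sensitivities -/

/-- `[folklore]` Below depth `b ≥ 1` the fibre mean of the level-`1` observable is its value at the
frozen level-`1` coordinate of the history (any Markov fibre kernels). -/
theorem fiberMean_obs {κ : (b : ℕ) → Kernel (Π i : Iic b, Level i) (Level (b + 1))}
    [∀ b, IsMarkovKernel (κ b)] {b : ℕ} (hb : 1 ≤ b) (u : Π i : Iic b, Level i) :
    fiberMean κ b obs u = Set.projIcc (-1 : ℝ) 1 (neg_le_self zero_le_one) (u ⟨1, mem_Iic.2 hb⟩) := by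
  rw [fiberMean_apply, Kernel.integral_traj u measurable_obs.aestronglyMeasurable]
  have h1 : (1 : ℕ) ∈ Iic b := mem_Iic.2 hb
  have h : ∀ x : Π n, Level n, obs (updateFinset x (Iic b) u) =
      Set.projIcc (-1 : ℝ) 1 (neg_le_self zero_le_one) (u ⟨1, h1⟩) := fun x => by
    simp only [obs, updateFinset, h1, dif_pos]
  simp [h]

/-- `[folklore]` The extension of a length-`b` history by a level-`b+1` value to a path. -/
def extendPath (b : ℕ) (h : Π i : Iic b, Level i) (y : ℝ) : Π n, Level n :=
  fun k => if hk : k ≤ b then h ⟨k, mem_Iic.2 hk⟩ else y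

/-- `[folklore]` Its length-`b` history is `h`. -/
theorem frestrictLe_extendPath (b : ℕ) (h : Π i : Iic b, Level i) (y : ℝ) :
    frestrictLe b (extendPath b h y) = h := by
  funext i; obtain ⟨k, hk⟩ := i; simp [extendPath, frestrictLe_apply, mem_Iic.1 hk]

/-- `[folklore]` Its level-`b+1` value is `y`. -/
theorem extendPath_succ (b : ℕ) (h : Π i : Iic b, Level i) (y : ℝ) :
    extendPath b h y (b + 1) = y := by
  simp [extendPath]

/-- `[folklore]` The one-step gluing, coordinate-wise (from `T4CouplingChain.succGlue_pair`). -/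
theorem succGlue_apply (b : ℕ) (h : Π i : Iic b, Level i) (y : ℝ) (j : Iic (b + 1)) :
    succGlue b (h, y) j = if hj : (j : ℕ) ≤ b then h ⟨j, mem_Iic.2 hj⟩ else y := by
  have e := succGlue_pair b (extendPath b h y)
  rw [frestrictLe_extendPath, extendPath_succ] at e
  rw [e, frestrictLe_apply]; rfl

/-- `[folklore]` **THE RAW EFRON–STEIN SENSITIVITIES OF THE TOY OBSERVABLE** (the binder `hc`):
`c_0 = 1` (the clamp is `1`-Lipschitz), `c_b = 0` for `b ≥ 1` (deeper steps do not move it). -/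
theorem lipOn_sens (lam : ℝ) (b : ℕ) (h : Π i : Iic b, Level i) :
    LipOn (fun _ : Unit => Set.Icc (-1 : ℝ) 1)
      (fun ξ : Unit → ℝ => fiberMean (stepKernel lam) (b + 1) obs (succGlue b (h, ξ ())))
      (fun _ => if b = 0 then (1 : ℝ) else 0) := by
  intro ξ _ l t _
  obtain ⟨⟩ := l
  simp only [fiberMean_obs (Nat.le_add_left 1 b), succGlue_apply, update_self]
  by_cases hb : b = 0
  · subst hb
    simp only [Nat.le_zero, one_ne_zero, if_true, dif_neg, not_false_eq_true, one_mul]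
    simpa using Set.abs_projIcc_sub_projIcc (neg_le_self zero_le_one) (c := t) (d := ξ ())
  · have h1 : 1 ≤ b := Nat.one_le_iff_ne_zero.2 hb
    simp [hb, h1]

/-! ## §4 The constants: lattice profile, coupling at the contraction threshold, rate -/

/-- `[folklore]` The lattice-sum constant `K_d(δ₁)` at the (5.7)-rate `δ₁ = delta1 d 1 1 1 1`. -/
def Kd (d : ℕ) : ℝ := B4Sect5Proof.latticeConst d (B4Sect5Proof.delta1 d 1 1 1 1)

/-- `[folklore]` `K_d ≥ 0`. -/
theorem Kd_nonneg (d : ℕ) : 0 ≤ Kd d :=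
  B4Sect5Proof.latticeConst_nonneg d (B4Sect5Proof.delta1_pos d 1 one_pos zero_le_one one_pos).le

/-- `[folklore]` The site-count constant `N = K_d + 1 ≥ 1` (any `N ≥ N₀ K_d(δ₁)` is admissible). -/
def Nd (d : ℕ) : ℝ := Kd d + 1

/-- `[folklore]` `N ≥ 1`. -/
theorem one_le_Nd (d : ℕ) : 1 ≤ Nd d := by
  have := Kd_nonneg d; unfold Nd; linarith

/-- `[folklore]` `N > 0`. -/
theorem Nd_pos (d : ℕ) : 0 < Nd d := lt_of_lt_of_le one_pos (one_le_Nd d)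

/-- `[folklore]` THE COUPLING `λ = 1/(256 N²)`: `hα` holds with EQUALITY at `α₀ = 1/2`. -/
def coupling (d : ℕ) : ℝ := 1 / (256 * Nd d ^ 2)

/-- `[folklore]` `λ > 0`: the toy interaction is NOT zero. -/
theorem coupling_pos (d : ℕ) : 0 < coupling d := by
  unfold coupling; exact div_pos one_pos (mul_pos (by norm_num) (pow_pos (Nd_pos d) 2))

/-- `[folklore]` The rate `ω = 8 λ N` of the exponential-moment smallness condition `hωb`. -/
def rate (d : ℕ) : ℝ := 8 * coupling d * Nd d

/-- `[folklore]` `ω ≥ 0`. -/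
theorem rate_nonneg (d : ℕ) : 0 ≤ rate d := by
  unfold rate; exact mul_nonneg (mul_nonneg (by norm_num) (coupling_pos d).le) (Nd_pos d).le

/-- `[folklore]` **THE CONTRACTION CONDITION HOLDS WITH EQUALITY**: with `p = 1`, `γ₀ = 1`,
`β_r = β_c = 1`, `ms2 = 2λ`, `δr = 1`, `q_r = q_c = 0`, the left side of `hα` is
`128 N² λ = 1/2`. -/
theorem smallness_eq (d : ℕ) :
    4 * (1 : ℝ) ^ 2 * ((2 / 1 * Nd d * 1) * (2 / 1 * Nd d * 1) *
      (4 * (2 * coupling d) / (1 : ℝ) ^ 2 + (1 / 2 : ℝ) * (0 + 0))) = 1 / 2 := by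
  have hN : Nd d ≠ 0 := (Nd_pos d).ne'
  unfold coupling; field_simp; ring

/-- `[folklore]` The exponential-moment condition `hωb` holds with equality: `2 · (2λ) · 2N = ω`. -/
theorem rate_eq (d : ℕ) :
    2 * (1 : ℝ) * ((2 * coupling d / 1 + (1 / 2 : ℝ) * (0 + 0) * 1) * (2 / 1 * Nd d * 1)) =
      rate d := by
  unfold rate; ring

/-! ## §5 The remaining binders, one lemma each, and the witness -/

/-- `[folklore]` Second moment of the reading under the reference law: `≤ 1`. -/
theorem integral_reading_sq_le : ∫ y, reading y ^ 2 ∂unitLaw ≤ 1 := by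
  have hb : ∀ y, |reading y ^ 2| ≤ 1 := fun y => by
    rw [abs_of_nonneg (sq_nonneg _)]
    have h := abs_reading_le y; have h0 := abs_nonneg (reading y); nlinarith [sq_abs (reading y)]
  exact (le_abs_self _).trans (abs_integral_le_of_abs_le_const
    ((continuous_reading.pow 2).measurable.aestronglyMeasurable) hb)

/-- `[folklore]` The localised term `ζ ↦ λ ζ` is bounded by `2λ` on the unit thickening of the raw
box `[-1, 1]` (`λ ≥ 0`). -/
theorem norm_term_le {lam : ℝ} (hlam : 0 ≤ lam) {ζ : Unit → ℂ}
    (hζ : ζ ∈ cthick (fun _ : Unit => Set.Icc (-1 : ℝ) 1) (fun _ => (1 : ℝ))) :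
    ‖(lam : ℂ) * ζ ()‖ ≤ 2 * lam := by
  obtain ⟨x, hx, hdist⟩ := hζ ()
  have hx1 : ‖(x : ℂ)‖ ≤ 1 := by rw [Complex.norm_real]; exact abs_le.2 ⟨hx.1, hx.2⟩
  have hζ2 : ‖ζ ()‖ ≤ 2 := by
    have h := norm_le_insert' (ζ ()) (x : ℂ); rw [← dist_eq_norm] at h; linarith
  rw [norm_mul, Complex.norm_real, Real.norm_eq_abs, abs_of_nonneg hlam]
  nlinarith

/-- `[folklore]` Coercivity of the Gram precision of `B = 1` with constant `1`. -/
theorem coercive_one : Coercive ((1 : Matrix Unit Unit ℝ)ᵀ * 1) 1 := by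
  intro x; simp [Matrix.one_mulVec]

/-- `[folklore]` Entrywise decay of the Gram precision of `B = 1` in any pseudo-distance vanishing
on the diagonal, with constants `c₀ = δ₀ = 1`. -/
theorem decay_one {d : ℕ} {Pv : Fin d → ℕ} (hPv : ∀ i, 1 ≤ Pv i) {Ω : Finset (TSite d Pv)} {N₀ : ℕ}
    (emb : Unit → TIdx Pv Ω N₀) (i j : Unit) :
    |((1 : Matrix Unit Unit ℝ)ᵀ * (1 : Matrix Unit Unit ℝ) : Matrix Unit Unit ℝ) i j| ≤
      1 * Real.exp (-(1 * embDist emb i j)) := by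
  obtain ⟨⟩ := i; obtain ⟨⟩ := j
  simp [(isPseudoDist_embDist hPv emb).zero]

/-- `[folklore]` The injected raw site: the origin of the torus, internal component `0`. -/
def origin {d : ℕ} {Pv : Fin d → ℕ} (hPv : ∀ i, 1 ≤ Pv i) :
    Unit → TIdx Pv (Finset.univ : Finset (TSite d Pv)) 1 :=
  fun _ => (⟨fun i => ⟨0, hPv i⟩, Finset.mem_univ _⟩, 0)

open scoped Classical in
/-- `[folklore]` **THE WITNESS.**  The end-to-end NE1′ tower bound of the lineage,
`T4PrecisionDecay.integral_sq_sub_towerMean_le_of_graded_geometric_analyticInteraction_precisionDecay_torus_pathLaw`,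
APPLIED with every binder discharged by the toy tower of this file: for every dimension `d`, every
period vector `Pv ≥ 1`, every depth `n ≥ 1` and every finite endpoint law `ν`, the variance of the
clamped level-`1` coordinate about its tower mean is at most `32 N² e^{ω} μ(univ)` (`N = Nd d`,
`ω = rate d`).  HONEST FRAMING: an inhabitation / non-vacuity certificate for the hypotheses of that
theorem; finite toy data; NOT a statement about Bałaban's tower, infinite volume, mass gap, Clay. -/
theorem witness (d : ℕ) {Pv : Fin d → ℕ} (hPv : ∀ i, 1 ≤ Pv i) (n : ℕ) (hn : 1 ≤ n)
    (ν : Measure ℝ) [IsFiniteMeasure ν] :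
    ∫ x, (obs x - towerMean (stepKernel (coupling d)) obs (x 0)) ^ 2
        ∂(Kernel.trajMeasure (X := Level) ν (stepKernel (coupling d))) ≤
      32 * Nd d ^ 2 * Real.exp (rate d) *
        (Kernel.trajMeasure (X := Level) ν (stepKernel (coupling d))).real Set.univ := by
  set lam : ℝ := coupling d with hlam
  have hlam0 : 0 ≤ lam := (coupling_pos d).le
  set μ : Measure (Π n, Level n) := Kernel.trajMeasure (X := Level) ν (stepKernel lam) with hμ
  have main :=
    integral_sq_sub_towerMean_le_of_graded_geometric_analyticInteraction_precisionDecay_torus_pathLaw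
      (X := Level) μ (stepKernel lam)
      (fun b => map_frestrictLe_succ_eq_compProd (κ := stepKernel lam) ν b) n (φ := obs) (R := 1)
      (stronglyMeasurable_frame_zero_of_level (X := Level) (k := 1) hn
        continuous_coe_projIcc.stronglyMeasurable)
      abs_obs_le (Λ := fun _ => Unit) (ι := fun _ => Unit) (E := fun _ _ => ℝ)
      (T := fun _ _ ξ => ξ ()) (fun _ _ => measurable_pi_apply _)
      (fun _ _ _ => (0 : ℝ)) (fun _ _ => (1 : Matrix Unit Unit ℝ))
      (e := fun _ _ => reading) (fun _ _ => continuous_reading.measurable)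
      (p := fun _ => (1 : ℝ)) (fun _ => zero_le_one) (fun _ _ y => abs_reading_le y)
      (fun _ _ _ => unitLaw) (v := 1) zero_le_one (fun _ _ _ => integral_reading_sq_le)
      (D := fun _ _ _ => Set.Icc (-1 : ℝ) 1)
      (fun b _ h η l => by
        have hw := abs_le.1 (abs_whitened_le η l)
        exact ⟨hw.1, hw.2⟩)
      (fun _ _ ξ => lam * ξ ()) (fun _ _ _ => by fun_prop) (a := fun _ _ => lam)
      (fun b _ h ξ hξ => by
        have h1 : |ξ ()| ≤ 1 := abs_le.2 ⟨(hξ ()).1, (hξ ()).2⟩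
        rw [abs_mul, abs_of_nonneg hlam0]
        exact mul_le_of_le_one_right hlam0 h1)
      (fun b _ h => rfl) (fun _ _ _ _ => convex_Icc _ _)
      (Ub := fun _ => (1 : ℝ)) (fun _ => zero_le_one) (fun _ _ _ _ t ht => abs_le.2 ⟨ht.1, ht.2⟩)
      (δr := fun _ => (1 : ℝ)) (fun _ => one_pos)
      (Tm := fun _ => Unit) (fun _ _ _ => Finset.univ) (fun _ _ _ ζ => (lam : ℂ) * ζ ())
      (fun _ _ _ _ => by
        intro ζ ζ' hζ
        simp [hζ () (Finset.mem_univ _)])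
      (fun _ _ _ => Set.univ) (fun _ _ _ _ => isOpen_univ) (fun _ _ _ _ => Set.subset_univ _)
      (fun _ _ _ _ => ((differentiable_apply ()).const_mul (lam : ℂ)).differentiableOn)
      (mX := fun _ _ _ => 2 * lam) (fun _ _ _ _ => by positivity)
      (fun _ _ _ _ ζ hζ => norm_term_le hlam0 hζ) (fun _ _ => (0 : Matrix Unit Unit ℝ))
      (qr := fun _ => (0 : ℝ)) (qc := fun _ => (0 : ℝ)) (fun _ => le_rfl) (fun _ => le_rfl)
      (fun _ _ _ _ => by simp) (fun _ _ _ _ => by simp) (fun _ _ _ ξ _ => by simp)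
      (ms1 := fun _ => 2 * lam) (ms2 := fun _ => 2 * lam)
      (fun _ => by positivity) (fun _ => by positivity)
      (fun _ _ _ _ => by simp) (fun _ _ _ _ => by simp)
      (c := fun b _ _ => if b = 0 then (1 : ℝ) else 0) (fun b _ h => lipOn_sens lam b h)
      (d := d) (Pv := fun _ => Pv) (fun _ => hPv) (fun _ => Finset.univ) 1 (fun _ => origin hPv)
      (fun _ => injective_of_subsingleton _)
      (γ₀ := 1) (c₀ := 1) (δ₀ := 1) one_pos zero_le_one one_pos (fun _ _ _ => coercive_one)
      (fun _ _ _ i j => decay_one hPv (origin hPv) i j) (N := Nd d) (by simp [Nd, Kd])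
      (βr := 1) (βc := 1) zero_le_one (fun _ _ _ i => by simp) zero_le_one
      (fun _ _ _ l => by simp)
      (α₀ := 1 / 2) (by norm_num) (fun _ => (smallness_eq d).le)
      (ω := rate d) (rate_nonneg d) (fun _ => (rate_eq d).le)
      (fun _ => stronglyMeasurable_const) (CW := 1) (fun b _ => by split_ifs <;> simp)
      (fun _ => Finset.univ) (C := 1) (κ₁ := 1) (Etot := 0) le_rfl
      (Θ := fun b => if b = 0 then (1 : ℝ) else 0)
      (J := fun _ => Unit) (fun _ _ => (∅ : Finset Unit))
      (Aev := fun _ _ _ => (∅ : Set (Π i : Iic _, Level i)))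
      (fun _ _ _ _ j hj => by simp at hj) (fun _ _ _ l hl => absurd (Finset.mem_univ l) hl)
      (fun b _ h l _ => by split_ifs <;> simp)
      (ε := fun _ _ _ => (0 : ℝ)) (fun _ _ _ _ _ _ => le_rfl) (fun _ _ _ _ => by simp)
      (fun b _ l _ S' hS' => by
        rw [Finset.subset_empty.1 hS']
        simp)
      (P := Real.exp (rate d) * (2 * 1 + 2 * (1 : ℝ) ^ 2)) (r := 1 / 2)
      (by positivity) (by norm_num) (by norm_num)
      (fun b => by
        by_cases hb : b = 0
        · subst hb; simp
        · simp [hb]; positivity)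
  refine main.trans (le_of_eq ?_)
  simp only [one_pow, sub_self, mul_zero, Real.exp_zero, mul_one, div_one]
  ring

/-- `[folklore]` **NON-DEGENERACY OF THE WITNESS DATA**: the interaction is nonzero and the
contraction condition is met with equality at `α₀ = 1/2` (no slack), so the smallness binders are
exercised, not bypassed. -/
theorem witness_nondegenerate (d : ℕ) :
    0 < coupling d ∧
      4 * (1 : ℝ) ^ 2 * ((2 / 1 * Nd d * 1) * (2 / 1 * Nd d * 1) *
        (4 * (2 * coupling d) / (1 : ℝ) ^ 2 + (1 / 2 : ℝ) * (0 + 0))) = 1 / 2 :=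
  ⟨coupling_pos d, smallness_eq d⟩

end Summit.QuantumFields.BalabanUV.T4Continuum.PrecisionDecayWitness
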